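/-
Origin: expansion seat `planner-pub-hodgecm-mc-axioms-1-g14-0`, handover #W132 2026-08-20T15:53:55Z md5 8fc94a28de1d (PKG 872e9d37975e → 8fc94a28de1d; 255 l.; MECHANICAL (iib-R) rewrite v3.1 of the PKG file as it stands (33 token edits; rules R1x1+RX[h₂']x32)) (`HOME/mc/pub-hodgecm-mc-axioms-1-g14/revendor/kit-r55/stage55/HodgeCM/Model/ArchKTypeOfLineSupply34.lean`, md5 8fc94a28de1d, 255 lines);
landed by the gen-22 packager (p-g22) in gate run 55 REPLACES the earlier landed copy of `HodgeCM/Model/ArchKTypeOfLineSupply34.lean` (seat copy carried the packager Origin header of an earlier run (stripped)).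
-/
/-
Copyright (c) 2026. Released under Apache 2.0 license as described in the file LICENSE.
Cell pub-hodgecm, MODEL layer (construction prover mc-carch-1, gen 5), BINDER-OWNERS rows 12 / 14 / 15 → row 17's (W-0-supply):
the `hsupply` text of binder-1's socket `Real34CensusSideT.ofCensus` (#56) ASSEMBLED from the carch At-tower, at a four-character side.
-/
import Summits.HodgeConjecture.HodgeCM.Model.ArchKTypeOfSlotAtCoset34_2
import Summits.HodgeConjecture.HodgeCM.Model.ArchKTypeOfDefiniteChar34
import Summits.HodgeConjecture.HodgeCM.Model.ArchKTypeOfFinChar34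
import Summits.HodgeConjecture.HodgeCM.Model.ArchKTypeOfLineTables34

/-!
# (W-0-supply) for lines 2, 3: `hsupply_two_three_charG`

binder-1-g12's row-17 socket `Gen12PinsP.Real34CensusSideT.ofCensus` (RUN 48 #56, `Model/Binders/Real34Census.lean` :192) takes

    hsupply : ∀ (x₂ x₃ : Fin 3 → 𝔸_{L⁺,f}) (𝔫₂ 𝔫₃ : Ideal 𝒪_{L⁺}),
      ∃ (B₂ : ArchKTypeDataAt 𝕏 2 x₂ 𝔫₂) (B₃ : ArchKTypeDataAt 𝕏 3 x₃ 𝔫₃),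
        B₃.Γ₀ = B₂.Γ₀ ∧ B₂.Φarch = Z₂ ∧ B₃.Φarch = Z₃ ∧ (row 14)₂ ∧ (row 15)₂ ∧ (row 14)₃ ∧ (row 15)₃.

This leaf PROVES that text at the side `𝕏 = thetaSpaceInputIn … (archSideOfChar V c hGR hGR₀ hGR₁ hGR₂ hGR₃ η₀ η₁ η₂ η₃ hmaj hrat A) hV` for the
VACUUM line families `Z₂ ∕ Z₃ := blockFamilyOfAt … (lineVec (dW' c.D 0∕1)) … (posIdxEquivUnit hpos) (negIdxEquivEmpty hpos) (degOnePDual Empty) (binvPi 1)`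
(degree-one `ι₁`-letter ⊗ vacuum at every other real place), from the line characters' four TYPE facts only:
`hdef₂ ∕ hdef₃` ((c5)₂/(c5)₃: «`c_k(archSingle_b u) · det(u)^{a_k(b)} = 1`» at carch's tables `defExponentTwo/Three`) and `hχ₂ ∕ hχ₃` ((χ)₂/(χ)₃ on
`Stab(x₀)` at the tuples of record `lineVacExponentsTwo/Three`), plus continuity of `η₂ η₃`, the plane sign `h₁W` and the branch `(mk ι₁).embedding = ι₁`.
Assembly: common level `Γ₀ := deepLevel V M`, `M := deepIndexTwoCosetG · deepIndexThreeCosetG` (#CA45), `hlevel` from theta-3's pin lemma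
`ThetaAdelicSide.exists_corrector_of_mem_levelImage`, terms #CA47 `archKTypeOfSlotTwo/ThreeAtCosetG`, `harch` by #CA44
`harch_two/three_of_defType_cosetG` over #CA49 `defExponentTwo/Three_spec`, `hfin` by #CA45 `hfin_two/three_deepLevelCosetG`, `hsec` by #CA13
`hsec_of_embedding_eq`, rows 14/15 by #CA47 `…_of_embedding_eqG`.
At pin R2 (`η₂ := etaT₂ η ν′`, `η₃ := etaT₃ η ν′`, `χV := χVR`, `ν₃ := ν₃R`) the four type facts are the guarded theorems of `ArchKTypeOfLineR2Family`,
so there `hsupply` is HYPOTHESIS-FREE under E's guard (next leaf, over period-1 #P50b `archSideOfT'`).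
0 records, 0 `def … : Prop`, nothing cited as a hypothesis.
-/

set_option autoImplicit false

noncomputable section

open NumberField NumberField.InfinitePlace NumberField.mixedEmbedding IsDedekindDomain
open scoped Matrix TensorProduct Classical SchwartzMap
open MulAction
open Literature.Geometry.ComplexHyperbolic.BallModel (U21 x₀ stabilizerEquivK21)
open Literature.NumberTheory.Automorphic.U21 (K21 matA sclD)
open Literature.AlgebraicGeometry.HodgeTheory
open Literature.AlgebraicGeometry.ShimuraVarieties Literature.AlgebraicGeometry.ShimuraVarieties.BallForms
open Literature.NumberTheory.Automorphic Literature.NumberTheory.Automorphic.UnitaryGroup Literature.NumberTheory.Weil1964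
open Literature.RepresentationTheory.KonnoKonno2007 Literature.RepresentationTheory.KonnoKonno2007.RealDualPair
open Literature.NumberTheory.GelbartRogawski1991 Literature.NumberTheory.GelbartRogawski1991.UnitaryDualPair
open Literature.Analysis.SegalBargmann Literature.Analysis.Distribution
open Literature.NumberTheory.Automorphic.PicardCM
open HodgeCM.Adelic HodgeCM.PerL34 HodgeCM.Model.HypCensus HodgeCM.Model.SupplyInstance HodgeCM.Model.ArchSideTerm

namespace HodgeCM.Model

section Supply

variable (hHD : exists_isReal_hodgeModel) (hI : hodgePQ_independent_of_hodgeModel)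
  (h₁ : BallQuotientUniformised)  (h₃ : CMAbelianVarietyRealised)

variable {L : CMField} {ι₁ : L →+* ℂ} (V : HermSpace3 L ι₁) (c : SeesawCtx L)
variable
  (hGR : (cmSplittingDatum (L : Type) finProdFinEquiv (frameD V) (frameD_real V) (frameD_ne V) (dW c.D) (dW_real c.D) (dW_ne c.D)).CompatibleSplitting)
  (hGR₀ : (cmSplittingDatum (L : Type) (e₁) (frameD V) (frameD_real V) (frameD_ne V) (lineVec (L : Type) (dW c.D 0))
    (fun _ => dW_real c.D 0) (fun _ => dW_ne c.D 0)).CompatibleSplitting)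
  (hGR₁ : (cmSplittingDatum (L : Type) (e₁) (frameD V) (frameD_real V) (frameD_ne V) (lineVec (L : Type) (dW c.D 1))
    (fun _ => dW_real c.D 1) (fun _ => dW_ne c.D 1)).CompatibleSplitting)
  (hGR₂ : (cmSplittingDatum (L : Type) (e₁) (frameD V) (frameD_real V) (frameD_ne V) (lineVec (L : Type) (dW' c.D 0))
    (fun _ => dW'_real c.D 0) (fun _ => dW'_ne c.D 0)).CompatibleSplitting)
  (hGR₃ : (cmSplittingDatum (L : Type) (e₁) (frameD V) (frameD_real V) (frameD_ne V) (lineVec (L : Type) (dW' c.D 1))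
    (fun _ => dW'_real c.D 1) (fun _ => dW'_ne c.D 1)).CompatibleSplitting)
  (η₀ η₁ η₂ η₃ : CMAdelic (L : Type) (frameD V) × CMAdelicOne (L : Type) →* ℂˣ)
  (hmaj : ∀ k : Fin 4, HasThetaMajorants fun (p : ↥(regimeSubgroup L V.Hm) × ↥(NumberField.relNormOneIdeles (↥(maximalRealSubfield L)) L))
      (φ : piSchwartzBruhat (↥(maximalRealSubfield L)) (Fin 3)) => lineRepOf V c.D hGR hGR₀ hGR₁ hGR₂ hGR₃ η₀ η₁ η₂ η₃ k p φ)
  (hrat : ∀ k : Fin 4, ∀ γ ∈ (V.latticeModel printFact_unitaryCompact_holds).Γ,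
      ∀ t ∈ NumberField.relNormOneRat (↥(maximalRealSubfield L)) L,
        lineRepOf V c.D hGR hGR₀ hGR₁ hGR₂ hGR₃ η₀ η₁ η₂ η₃ k (γ, t) ∈ thetaStabilizerEnd (↥(maximalRealSubfield L)) (Fin 3))
  (h₁W : (∀ j, 0 < (ι₁ (dW c.D j)).re) ∨ ∀ j, (ι₁ (dW c.D j)).re < 0)
  (A : ∀ k : Fin 4, ArchLineInput V (lineRepOf V c.D hGR hGR₀ hGR₁ hGR₂ hGR₃ η₀ η₁ η₂ η₃ k))
  (hV : IsAnisotropic L V.Hm) (hemb : (InfinitePlace.mk ι₁).embedding = ι₁)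
  (hpos₂ : 0 < cmXW (L : Type) (frameD V) (lineVec (L : Type) (dW' c.D 0)) (fun _ => dW'_real c.D 0) ι₁ (HypCensus.cmPlace (L : Type) ι₁) 0)
  (hpos₃ : 0 < cmXW (L : Type) (frameD V) (lineVec (L : Type) (dW' c.D 1)) (fun _ => dW'_real c.D 1) ι₁ (HypCensus.cmPlace (L : Type) ι₁) 0)
  (hη₂c : Continuous fun p => ((η₂ p : ℂˣ) : ℂ)) (hη₃c : Continuous fun p => ((η₃ p : ℂˣ) : ℂ))
  (hdef₂ : ∀ b : {v : InfinitePlace ↥(maximalRealSubfield L) // v.IsReal}, b ≠ HypCensus.cmPlace (L : Type) ι₁ →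
    ∀ u : UnitaryGroup.archLocal (L : Type) 3 (Matrix.diagonal (frameD V)) (cmPlaceOver (L : Type) b),
      ((archScalar_twoG V c.D hGR hGR₂ hGR₃ η₂
          (UnitaryGroup.archSingle (↥(maximalRealSubfield L)) L (IsCMField.complexConj L) 3 (Matrix.diagonal (frameD V))
            (IsCMField.complexConj_ne_one L) (NumberField.complexConj_smul_infinitePlace (L : Type)) (cmPlaceOver (L : Type) b) u) : ℂˣ) : ℂ) *
        (((u : UnitaryGroup.archLocal (L : Type) 3 (Matrix.diagonal (frameD V)) (cmPlaceOver (L : Type) b)) : GL (Fin 3) ℂ) :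
            Matrix (Fin 3) (Fin 3) ℂ).det ^ defExponentTwo V c hGR₂ hpos₂ b = 1)
  (hdef₃ : ∀ b : {v : InfinitePlace ↥(maximalRealSubfield L) // v.IsReal}, b ≠ HypCensus.cmPlace (L : Type) ι₁ →
    ∀ u : UnitaryGroup.archLocal (L : Type) 3 (Matrix.diagonal (frameD V)) (cmPlaceOver (L : Type) b),
      ((archScalar_threeG V c.D hGR hGR₂ hGR₃ η₃
          (UnitaryGroup.archSingle (↥(maximalRealSubfield L)) L (IsCMField.complexConj L) 3 (Matrix.diagonal (frameD V))
            (IsCMField.complexConj_ne_one L) (NumberField.complexConj_smul_infinitePlace (L : Type)) (cmPlaceOver (L : Type) b) u) : ℂˣ) : ℂ) *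
        (((u : UnitaryGroup.archLocal (L : Type) 3 (Matrix.diagonal (frameD V)) (cmPlaceOver (L : Type) b)) : GL (Fin 3) ℂ) :
            Matrix (Fin 3) (Fin 3) ℂ).det ^ defExponentThree V c hGR₃ hpos₃ b = 1)
  (hχ₂ : ∀ u : stabilizer U21 x₀,
    ((lineScalar_two V c.D hGR hGR₂ hGR₃ η₂ (u : U21) : ℂˣ) : ℂ) *
        ((matA (stabilizerEquivK21.symm u)).det ^ (lineVacExponentsTwo V c hGR₂ (posIdxEquivUnit hpos₂) (negIdxEquivEmpty hpos₂)).eP *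
          sclD (stabilizerEquivK21.symm u) ^ (lineVacExponentsTwo V c hGR₂ (posIdxEquivUnit hpos₂) (negIdxEquivEmpty hpos₂)).eQ) =
      star (sclD (stabilizerEquivK21.symm u)))
  (hχ₃ : ∀ u : stabilizer U21 x₀,
    ((lineScalar_three V c.D hGR hGR₂ hGR₃ η₃ (u : U21) : ℂˣ) : ℂ) *
        ((matA (stabilizerEquivK21.symm u)).det ^ (lineVacExponentsThree V c hGR₃ (posIdxEquivUnit hpos₃) (negIdxEquivEmpty hpos₃)).eP *
          sclD (stabilizerEquivK21.symm u) ^ (lineVacExponentsThree V c hGR₃ (posIdxEquivUnit hpos₃) (negIdxEquivEmpty hpos₃)).eQ) =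
      star (sclD (stabilizerEquivK21.symm u)))

/-- `hlevel` for the four-character side at every level (theta-3's pin lemma; = #CA17 `hlevel_of_side`, restated to keep this leaf light). -/
theorem hlevel_charG (Γ₀ : Level V) :
    ∀ δ ∈ levelImage hHD hI h₁ h₃ Γ₀ hV, ∃ x : (V.latticeModel printFact_unitaryCompact_holds).G,
      x ∈ (satLevelRegimeOf V hV Γ₀.K : Subgroup (V.latticeModel printFact_unitaryCompact_holds).G) ∧
        (archSideOfChar V c hGR hGR₀ hGR₁ hGR₂ hGR₃ η₀ η₁ η₂ η₃ hmaj hrat A).ιinf δ * x ∈ (V.latticeModel printFact_unitaryCompact_holds).Γ := by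
  intro δ hδ
  obtain ⟨x, hx, hΓ, -⟩ := ThetaAdelicSide.exists_corrector_of_mem_levelImage hHD hI h₁ h₃
    (archSideOfChar V c hGR hGR₀ hGR₁ hGR₂ hGR₃ η₀ η₁ η₂ η₃ hmaj hrat A) Γ₀ hV δ hδ
  exact ⟨x, hx, hΓ⟩

variable (x₂ x₃ : Fin 3 → FiniteAdeleRing (𝓞 ↥(maximalRealSubfield L)) ↥(maximalRealSubfield L)) (𝔫₂ 𝔫₃ : Ideal (𝓞 ↥(maximalRealSubfield L)))

/-! ### the common deep level of a pair of thin cosets -/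

/-- **the common (D-2) index of the pair of cosets**: `n₂(x₂, 𝔫₂) · n₃(x₃, 𝔫₃)` (#CA45 `deepIndexTwo/ThreeCosetG`). -/
def supplyIndexG : ℕ :=
  deepIndexTwoCosetG V c.D hGR hGR₂ hGR₃ η₂ hη₂c h₁W x₂ 𝔫₂ * deepIndexThreeCosetG V c.D hGR hGR₂ hGR₃ η₃ hη₃c x₃ 𝔫₃

/-- (Ported verbatim from the HodgeCMPerL package; no docstring in the source.) -/
theorem supplyIndexG_ne_zero : supplyIndexG V c hGR hGR₂ hGR₃ η₂ η₃ h₁W hη₂c hη₃c x₂ x₃ 𝔫₂ 𝔫₃ ≠ 0 :=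
  mul_ne_zero (deepIndexTwo_ne_zeroCosetG V c.D hGR hGR₂ hGR₃ η₂ hη₂c h₁W x₂ 𝔫₂) (deepIndexThree_ne_zeroCosetG V c.D hGR hGR₂ hGR₃ η₃ hη₃c x₃ 𝔫₃)

/-- the common level `Γ₀ := deepLevel V (n₂ n₃)`. -/
def supplyLevelG : Level V :=
  deepLevel V _ (supplyIndexG_ne_zero V c hGR hGR₂ hGR₃ η₂ η₃ h₁W hη₂c hη₃c x₂ x₃ 𝔫₂ 𝔫₃)

/-! ### the two terms on the common level -/

/-- **`B₂`**: #CA47's line-2 term at the coset `x₂ + 𝔫₂𝒪̂³` on the common level, vacuum elsewhere (`Φ₂ := binvPi 1`), its four inputs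
discharged from `hdef₂` / `hχ₂` (+ #CA49 `defExponentTwo_spec`, #CA45 `hfin_two_deepLevelCosetG`, #CA13 `hsec_of_embedding_eq`). -/
def supplyTwoCharG :
    ArchKTypeDataAt (thetaSpaceInputIn hHD hI h₁ h₃ (archSideOfChar V c hGR hGR₀ hGR₁ hGR₂ hGR₃ η₀ η₁ η₂ η₃ hmaj hrat A) hV) 2 x₂ 𝔫₂ :=
  archKTypeOfSlotTwoAtCosetG hHD hI h₁ h₃ V c hGR hGR₀ hGR₁ hGR₂ hGR₃ η₀ η₁ η₂ η₃ hmaj hrat A hV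
    (supplyLevelG V c hGR hGR₂ hGR₃ η₂ η₃ h₁W hη₂c hη₃c x₂ x₃ 𝔫₂ 𝔫₃)
    (hlevel_charG hHD hI h₁ h₃ V c hGR hGR₀ hGR₁ hGR₂ hGR₃ η₀ η₁ η₂ η₃ hmaj hrat A hV _) (binvPi 1)
    (posIdxEquivUnit hpos₂) (negIdxEquivEmpty hpos₂) x₂ 𝔫₂
    (harch_two_of_defType_cosetG V c.D hGR hGR₀ hGR₁ hGR₂ hGR₃ η₀ η₁ η₂ η₃ hV (posIdxEquivUnit hpos₂) (negIdxEquivEmpty hpos₂) x₂ 𝔫₂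
      (defExponentTwo V c hGR₂ hpos₂) (defExponentTwo_spec V c hGR₂ hpos₂) hdef₂)
    (hfin_two_deepLevelCosetG V c.D hGR hGR₀ hGR₁ hGR₂ hGR₃ η₀ η₁ η₂ η₃ hV hη₂c h₁W x₂ 𝔫₂
      (supplyIndexG_ne_zero V c hGR hGR₂ hGR₃ η₂ η₃ h₁W hη₂c hη₃c x₂ x₃ 𝔫₂ 𝔫₃) (dvd_mul_right _ _))
    (hsec_of_embedding_eq V (lineVec (L : Type) (dW' c.D 0)) (fun _ => dW'_real c.D 0) (fun _ => dW'_ne c.D 0) _ _ hemb) hχ₂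

/-- **`B₃`**: #CA47's line-3 term at the coset `x₃ + 𝔫₃𝒪̂³` on the same level. -/
def supplyThreeCharG :
    ArchKTypeDataAt (thetaSpaceInputIn hHD hI h₁ h₃ (archSideOfChar V c hGR hGR₀ hGR₁ hGR₂ hGR₃ η₀ η₁ η₂ η₃ hmaj hrat A) hV) 3 x₃ 𝔫₃ :=
  archKTypeOfSlotThreeAtCosetG hHD hI h₁ h₃ V c hGR hGR₀ hGR₁ hGR₂ hGR₃ η₀ η₁ η₂ η₃ hmaj hrat A hV
    (supplyLevelG V c hGR hGR₂ hGR₃ η₂ η₃ h₁W hη₂c hη₃c x₂ x₃ 𝔫₂ 𝔫₃)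
    (hlevel_charG hHD hI h₁ h₃ V c hGR hGR₀ hGR₁ hGR₂ hGR₃ η₀ η₁ η₂ η₃ hmaj hrat A hV _) (binvPi 1)
    (posIdxEquivUnit hpos₃) (negIdxEquivEmpty hpos₃) x₃ 𝔫₃
    (harch_three_of_defType_cosetG V c.D hGR hGR₀ hGR₁ hGR₂ hGR₃ η₀ η₁ η₂ η₃ hV (posIdxEquivUnit hpos₃) (negIdxEquivEmpty hpos₃) x₃ 𝔫₃
      (defExponentThree V c hGR₃ hpos₃) (defExponentThree_spec V c hGR₃ hpos₃) hdef₃)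
    (hfin_three_deepLevelCosetG V c.D hGR hGR₀ hGR₁ hGR₂ hGR₃ η₀ η₁ η₂ η₃ hV hη₃c x₃ 𝔫₃
      (supplyIndexG_ne_zero V c hGR hGR₂ hGR₃ η₂ η₃ h₁W hη₂c hη₃c x₂ x₃ 𝔫₂ 𝔫₃) (dvd_mul_left _ _))
    (hsec_of_embedding_eq V (lineVec (L : Type) (dW' c.D 1)) (fun _ => dW'_real c.D 1) (fun _ => dW'_ne c.D 1) _ _ hemb) hχ₃

/-! ### read-backs and rows 14/15 -/

/-- (Ported verbatim from the HodgeCMPerL package; no docstring in the source.) -/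
theorem supplyTwoCharG_Γ₀ :
    (supplyTwoCharG hHD hI h₁ h₃ V c hGR hGR₀ hGR₁ hGR₂ hGR₃ η₀ η₁ η₂ η₃ hmaj hrat h₁W A hV hemb hpos₂ hη₂c hη₃c hdef₂ hχ₂ x₂ x₃ 𝔫₂ 𝔫₃).Γ₀ =
      supplyLevelG V c hGR hGR₂ hGR₃ η₂ η₃ h₁W hη₂c hη₃c x₂ x₃ 𝔫₂ 𝔫₃ :=
  rfl

/-- (Ported verbatim from the HodgeCMPerL package; no docstring in the source.) -/
theorem supplyThreeCharG_Γ₀ :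
    (supplyThreeCharG hHD hI h₁ h₃ V c hGR hGR₀ hGR₁ hGR₂ hGR₃ η₀ η₁ η₂ η₃ hmaj hrat h₁W A hV hemb hpos₃ hη₂c hη₃c hdef₃ hχ₃ x₂ x₃ 𝔫₂ 𝔫₃).Γ₀ =
      supplyLevelG V c hGR hGR₂ hGR₃ η₂ η₃ h₁W hη₂c hη₃c x₂ x₃ 𝔫₂ 𝔫₃ :=
  rfl

/-- (Ported verbatim from the HodgeCMPerL package; no docstring in the source.) -/
theorem supplyTwoCharG_Φarch :
    (supplyTwoCharG hHD hI h₁ h₃ V c hGR hGR₀ hGR₁ hGR₂ hGR₃ η₀ η₁ η₂ η₃ hmaj hrat h₁W A hV hemb hpos₂ hη₂c hη₃c hdef₂ hχ₂ x₂ x₃ 𝔫₂ 𝔫₃).Φarch =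
      blockFamilyOfAt (L : Type) e₁ (frameD V) (frameD_real V) (frameD_ne V) (lineVec (L : Type) (dW' c.D 0)) (fun _ => dW'_real c.D 0)
        (fun _ => dW'_ne c.D 0) ι₁ (blockPosEquiv V) (blockNegEquiv V) (posIdxEquivUnit hpos₂) (negIdxEquivEmpty hpos₂) (degOnePDual Empty) (binvPi 1) :=
  rfl

/-- (Ported verbatim from the HodgeCMPerL package; no docstring in the source.) -/
theorem supplyThreeCharG_Φarch :
    (supplyThreeCharG hHD hI h₁ h₃ V c hGR hGR₀ hGR₁ hGR₂ hGR₃ η₀ η₁ η₂ η₃ hmaj hrat h₁W A hV hemb hpos₃ hη₂c hη₃c hdef₃ hχ₃ x₂ x₃ 𝔫₂ 𝔫₃).Φarch =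
      blockFamilyOfAt (L : Type) e₁ (frameD V) (frameD_real V) (frameD_ne V) (lineVec (L : Type) (dW' c.D 1)) (fun _ => dW'_real c.D 1)
        (fun _ => dW'_ne c.D 1) ι₁ (blockPosEquiv V) (blockNegEquiv V) (posIdxEquivUnit hpos₃) (negIdxEquivEmpty hpos₃) (degOnePDual Empty) (binvPi 1) :=
  rfl

/-- row 14 for `B₂` along `expP`. -/
theorem isWeaklyPDiff_supplyTwoCharG :
    (supplyTwoCharG hHD hI h₁ h₃ V c hGR hGR₀ hGR₁ hGR₂ hGR₃ η₀ η₁ η₂ η₃ hmaj hrat h₁W A hV hemb hpos₂ hη₂c hη₃c hdef₂ hχ₂ x₂ x₃ 𝔫₂ 𝔫₃).IsWeaklyPDiff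
      BallForms.expP :=
  isWeaklyPDiff_archKTypeOfSlotTwoAtCoset_of_embedding_eqG hHD hI h₁ h₃ V c hGR hGR₀ hGR₁ hGR₂ hGR₃ η₀ η₁ η₂ η₃ hmaj hrat A hV _ _ _ _ _ x₂ 𝔫₂
    _ _ _ hχ₂ hemb

/-- row 15 for `B₂` along `expP`. -/
theorem isPMinusKilledAlong_supplyTwoCharG (p : Fin 2) :
    (supplyTwoCharG hHD hI h₁ h₃ V c hGR hGR₀ hGR₁ hGR₂ hGR₃ η₀ η₁ η₂ η₃ hmaj hrat h₁W A hV hemb hpos₂ hη₂c hη₃c hdef₂ hχ₂ x₂ x₃ 𝔫₂ 𝔫₃).IsPMinusKilledAlong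
      BallForms.expP (-Complex.I • (Pi.single p 1 : Fin 2 → ℂ)) :=
  isPMinusKilledAlong_archKTypeOfSlotTwoAtCoset_of_embedding_eqG hHD hI h₁ h₃ V c hGR hGR₀ hGR₁ hGR₂ hGR₃ η₀ η₁ η₂ η₃ hmaj hrat A hV _ _ _ _ _
    x₂ 𝔫₂ _ _ _ hχ₂ hemb p

/-- row 14 for `B₃` along `expP`. -/
theorem isWeaklyPDiff_supplyThreeCharG :
    (supplyThreeCharG hHD hI h₁ h₃ V c hGR hGR₀ hGR₁ hGR₂ hGR₃ η₀ η₁ η₂ η₃ hmaj hrat h₁W A hV hemb hpos₃ hη₂c hη₃c hdef₃ hχ₃ x₂ x₃ 𝔫₂ 𝔫₃).IsWeaklyPDiff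
      BallForms.expP :=
  isWeaklyPDiff_archKTypeOfSlotThreeAtCoset_of_embedding_eqG hHD hI h₁ h₃ V c hGR hGR₀ hGR₁ hGR₂ hGR₃ η₀ η₁ η₂ η₃ hmaj hrat A hV _ _ _ _ _ x₃
    𝔫₃ _ _ _ hχ₃ hemb

/-- row 15 for `B₃` along `expP`. -/
theorem isPMinusKilledAlong_supplyThreeCharG (p : Fin 2) :
    (supplyThreeCharG hHD hI h₁ h₃ V c hGR hGR₀ hGR₁ hGR₂ hGR₃ η₀ η₁ η₂ η₃ hmaj hrat h₁W A hV hemb hpos₃ hη₂c hη₃c hdef₃ hχ₃ x₂ x₃ 𝔫₂ 𝔫₃).IsPMinusKilledAlong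
      BallForms.expP (-Complex.I • (Pi.single p 1 : Fin 2 → ℂ)) :=
  isPMinusKilledAlong_archKTypeOfSlotThreeAtCoset_of_embedding_eqG hHD hI h₁ h₃ V c hGR hGR₀ hGR₁ hGR₂ hGR₃ η₀ η₁ η₂ η₃ hmaj hrat A hV _ _ _ _
    _ x₃ 𝔫₃ _ _ _ hχ₃ hemb p

/-! ### the `hsupply` text -/

include hemb hη₂c hη₃c h₁W hdef₂ hdef₃ hχ₂ hχ₃ in
omit x₂ x₃ 𝔫₂ 𝔫₃ in
/-- **(W-0-SUPPLY) FOR LINES 2, 3 — binder-1's `hsupply` text at the four-character side**: for every pair of thin cosets `x₂ + 𝔫₂𝒪̂³`, `x₃ + 𝔫₃𝒪̂³`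
there are row-12 terms `B₂`, `B₃` in `ArchKTypeDataAt` currency ON ONE COMMON LEVEL (`deepLevel V (n₂·n₃)`), with harmonic families the vacuum
line families `Z₂`, `Z₃`, satisfying rows 14 and 15 along `expP`. -/
theorem hsupply_two_three_charG :
    ∀ (x₂ x₃ : Fin 3 → FiniteAdeleRing (𝓞 ↥(maximalRealSubfield L)) ↥(maximalRealSubfield L)) (𝔫₂ 𝔫₃ : Ideal (𝓞 ↥(maximalRealSubfield L))),
      ∃ (B₂ : ArchKTypeDataAt (thetaSpaceInputIn hHD hI h₁ h₃ (archSideOfChar V c hGR hGR₀ hGR₁ hGR₂ hGR₃ η₀ η₁ η₂ η₃ hmaj hrat A) hV) 2 x₂ 𝔫₂)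
        (B₃ : ArchKTypeDataAt (thetaSpaceInputIn hHD hI h₁ h₃ (archSideOfChar V c hGR hGR₀ hGR₁ hGR₂ hGR₃ η₀ η₁ η₂ η₃ hmaj hrat A) hV) 3 x₃ 𝔫₃),
        B₃.Γ₀ = B₂.Γ₀ ∧
          B₂.Φarch = blockFamilyOfAt (L : Type) e₁ (frameD V) (frameD_real V) (frameD_ne V) (lineVec (L : Type) (dW' c.D 0)) (fun _ => dW'_real c.D 0)
            (fun _ => dW'_ne c.D 0) ι₁ (blockPosEquiv V) (blockNegEquiv V) (posIdxEquivUnit hpos₂) (negIdxEquivEmpty hpos₂) (degOnePDual Empty) (binvPi 1) ∧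
          B₃.Φarch = blockFamilyOfAt (L : Type) e₁ (frameD V) (frameD_real V) (frameD_ne V) (lineVec (L : Type) (dW' c.D 1)) (fun _ => dW'_real c.D 1)
            (fun _ => dW'_ne c.D 1) ι₁ (blockPosEquiv V) (blockNegEquiv V) (posIdxEquivUnit hpos₃) (negIdxEquivEmpty hpos₃) (degOnePDual Empty) (binvPi 1) ∧
          B₂.IsWeaklyPDiff BallForms.expP ∧
          (∀ p : Fin 2, B₂.IsPMinusKilledAlong BallForms.expP (-Complex.I • (Pi.single p 1 : Fin 2 → ℂ))) ∧
          B₃.IsWeaklyPDiff BallForms.expP ∧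
          (∀ p : Fin 2, B₃.IsPMinusKilledAlong BallForms.expP (-Complex.I • (Pi.single p 1 : Fin 2 → ℂ))) :=
  fun x₂ x₃ 𝔫₂ 𝔫₃ =>
  ⟨supplyTwoCharG hHD hI h₁ h₃ V c hGR hGR₀ hGR₁ hGR₂ hGR₃ η₀ η₁ η₂ η₃ hmaj hrat h₁W A hV hemb hpos₂ hη₂c hη₃c hdef₂ hχ₂ x₂ x₃ 𝔫₂ 𝔫₃,
    supplyThreeCharG hHD hI h₁ h₃ V c hGR hGR₀ hGR₁ hGR₂ hGR₃ η₀ η₁ η₂ η₃ hmaj hrat h₁W A hV hemb hpos₃ hη₂c hη₃c hdef₃ hχ₃ x₂ x₃ 𝔫₂ 𝔫₃,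
    (supplyThreeCharG_Γ₀ hHD hI h₁ h₃ V c hGR hGR₀ hGR₁ hGR₂ hGR₃ η₀ η₁ η₂ η₃ hmaj hrat h₁W A hV hemb hpos₃ hη₂c hη₃c hdef₃ hχ₃ x₂ x₃ 𝔫₂ 𝔫₃).trans
      (supplyTwoCharG_Γ₀ hHD hI h₁ h₃ V c hGR hGR₀ hGR₁ hGR₂ hGR₃ η₀ η₁ η₂ η₃ hmaj hrat h₁W A hV hemb hpos₂ hη₂c hη₃c hdef₂ hχ₂ x₂ x₃ 𝔫₂ 𝔫₃).symm,
    supplyTwoCharG_Φarch hHD hI h₁ h₃ V c hGR hGR₀ hGR₁ hGR₂ hGR₃ η₀ η₁ η₂ η₃ hmaj hrat h₁W A hV hemb hpos₂ hη₂c hη₃c hdef₂ hχ₂ x₂ x₃ 𝔫₂ 𝔫₃,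
    supplyThreeCharG_Φarch hHD hI h₁ h₃ V c hGR hGR₀ hGR₁ hGR₂ hGR₃ η₀ η₁ η₂ η₃ hmaj hrat h₁W A hV hemb hpos₃ hη₂c hη₃c hdef₃ hχ₃ x₂ x₃ 𝔫₂ 𝔫₃,
    isWeaklyPDiff_supplyTwoCharG hHD hI h₁ h₃ V c hGR hGR₀ hGR₁ hGR₂ hGR₃ η₀ η₁ η₂ η₃ hmaj hrat h₁W A hV hemb hpos₂ hη₂c hη₃c hdef₂ hχ₂ x₂ x₃ 𝔫₂ 𝔫₃,
    isPMinusKilledAlong_supplyTwoCharG hHD hI h₁ h₃ V c hGR hGR₀ hGR₁ hGR₂ hGR₃ η₀ η₁ η₂ η₃ hmaj hrat h₁W A hV hemb hpos₂ hη₂c hη₃c hdef₂ hχ₂ x₂ x₃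
      𝔫₂ 𝔫₃,
    isWeaklyPDiff_supplyThreeCharG hHD hI h₁ h₃ V c hGR hGR₀ hGR₁ hGR₂ hGR₃ η₀ η₁ η₂ η₃ hmaj hrat h₁W A hV hemb hpos₃ hη₂c hη₃c hdef₃ hχ₃ x₂ x₃ 𝔫₂ 𝔫₃,
    isPMinusKilledAlong_supplyThreeCharG hHD hI h₁ h₃ V c hGR hGR₀ hGR₁ hGR₂ hGR₃ η₀ η₁ η₂ η₃ hmaj hrat h₁W A hV hemb hpos₃ hη₂c hη₃c hdef₃ hχ₃ x₂ x₃
      𝔫₂ 𝔫₃⟩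

end Supply

end HodgeCM.Model

end
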